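import Summits.HubbardSuperconductivity.HubbardSuperconductivity.Theorems.AnisotropyChordTransferFibre3FinXBSym

/-!
# Route `AnisotropyChord` / H0 rotor rung: FIN combined (rows `N₁` + C) certificate at `L = 19` — cell facts, part `cg`

Kernel facts `xbcCellAny 19 (49/50) 20 la lb (c, bn) = true` (via the symmetric-table evaluator `xbcCellAnyW` of `…FinXBSym`: `rw [← xbcCellAnyW_eq]; decide +kernel`, zero data) for 1 λ-cells of the per-`L` cover
(`…FinXCCover.xbcCheck`; cell design: p3 g6 (g5 generator) scratch `xbc_design.py`, mirrors `xb_mirror.py`/`xc_mirror.py`); assembled in `…FinXBCNineteen`.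
Prover seat `hubbard-h0-rotor-p3` g5; helper for piece A = stmt-HubbardSuperconductivity-23918 of rung 19089 (`--supports`, helper class).
WHAT THIS IS NOT: nothing here proves superconductivity in the Hubbard model (rotor TARGET as worded stays FALSE, g15 verdict); kernel facts for the FIN certificate of two hypotheses (rows `N₁`, C) of ONE conditional reduction.  Tree imports only; no sorry, no new axioms.
-/

set_option linter.dupNamespace false

namespace Summit.HubbardSuperconductivity.HubbardSuperconductivity.Theorems.AnisotropyChord.Transfer.Fibre3

namespace FinXB

set_option maxHeartbeats 4000000 in
/-- kernel fact: cell 98 at `L = 19` (certified, c = (11/20 : ℚ), b = 15/20). [folklore] -/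
theorem xbc19_98 : xbcCellAny 19 (49/50 : ℚ) 20 1715725473323056 1758618610156133 ((11/20 : ℚ), (15 : ℕ)) = true := by
  rw [← xbcCellAnyW_eq]
  decide +kernel

end FinXB

end Summit.HubbardSuperconductivity.HubbardSuperconductivity.Theorems.AnisotropyChord.Transfer.Fibre3
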